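import Literature.Computability.Cryptography.OrderFindingPostEuclid
import Literature.Computability.Cryptography.ShorPerfectPowerFP
import Literature.Computability.Complexity.LengthCompare
import HarnessLib

/-!
# Shor's order-finding post-processor is polynomial time, IIIb: the continued-fraction scan as a machine

Family `PQC`; the third `FP` stage of `orderFindingPost` (`ShorOrderFindingQuantum.lean`; plan in
`OrderFindingPostCounts.lean`), written in the brick algebra (`BrickAlgebra.lean`) around the model
`OFPostB.cfNext` of `OrderFindingPostEuclid.lean` (Shor 1997, §5, p. 15 of arXiv quant-ph/9508027v2, the sentence on p. 18:
the nearest fraction with denominator `< n` "can be found in polynomial time by using a continued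
fraction expansion"):

* context `x = ⟨n, ⟨2q, ⟨A, D⟩⟩⟩` (`xrec`), state `⟨a, ⟨b, ⟨p₁, ⟨q₁, ⟨p₀, ⟨q₀, res⟩⟩⟩⟩⟩⟩` (`srec`),
  loop record `⟨⟨x, u⟩, ⟨counter, state⟩⟩` (`lrec`) and their projections;
* the body `cfBody` (idle once `b = 0`; a length cap `|b|, |p|, |q'| ≤ |⟨x, u⟩|`, never active on
  the states of the model by `evalFrac_quots_le`, bounds the growth on malformed records),
  `cfBody_mem_FP`, `length_cfBody_le`, `cfBody_lrec` (one round on a coded state is the coded next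
  state), `cap_iterate`, `loopModel_cfBody`;
* **`cfScanF`** (`|u|` rounds by `loopFn_mem_FP`, then the result field), `cfScanF_mem_FP` and
  **`cfScanF_apply : cfScanF ⟨⟨n, ⟨2q, ⟨A, D⟩⟩⟩, u⟩ = encodeNat (cfCandidate n q A D |u|)`**.

## References

* P. W. Shor, SIAM J. Comput. 26 (1997) 1484–1509, §5 (p. 15 of arXiv:quant-ph/9508027v2; the quoted sentence p. 18).
* G. H. Hardy, E. M. Wright, *An Introduction to the Theory of Numbers*, 6th ed. 2008, §10.2 (Thm. 149).
* S. Arora, B. Barak, *Computational Complexity: A Modern Approach*, CUP 2009, §1.3 (closure of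
  polynomial time under composition and bounded loops), §1.4.1.
-/

noncomputable section

namespace Literature.Computability.Cryptography

namespace OFPostB

open _root_.Computability Polynomial Complexity Complexity.Brick OFPostCF ShorFP

/-! ### Coded contexts and states -/

-- keep the field abbreviations syntactically stable under `simp`
attribute [-simp] Brick.nthF_zero Brick.sndPow_zero

/-- The coded context `⟨n, ⟨2q, ⟨A, D⟩⟩⟩`. [folklore] -/
def xrec (n q A D : ℕ) : List Bool :=
  boolPair (encodeNat n) (boolPair (encodeNat (2 * q)) (boolPair (encodeNat A) (encodeNat D)))

/-- A seven-field record. [folklore] -/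
def st7 (a b c d e f g : List Bool) : List Bool :=
  boolPair a (boolPair b (boolPair c (boolPair d (boolPair e (boolPair f g)))))

/-- The coded state. [folklore] -/
def srec (s : CF) : List Bool :=
  st7 (encodeNat s.a) (encodeNat s.b) (encodeNat s.p₁) (encodeNat s.q₁) (encodeNat s.p₀) (encodeNat s.q₀) (encodeNat s.res)

/-- The record of the loop: `⟨⟨x, u⟩, ⟨counter, state⟩⟩`. [folklore] -/
def lrec (xu cnt st : List Bool) : List Bool := boolPair xu (boolPair cnt st)

/-! ### Base projections (the record definitions are never unfolded elsewhere) -/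

section Base

variable (n q A D : ℕ) (xu cnt st : List Bool) (s : CF)

/-- Field `0` of the loop record. [folklore] -/
@[simp] theorem nthF_zero_lrec : nthF 0 (lrec xu cnt st) = xu := by simp [lrec]
/-- First component of the loop record. [folklore] -/
@[simp] theorem fstF_lrec : fstF (lrec xu cnt st) = xu := by simp [lrec]
/-- The state of the loop record. [folklore] -/
@[simp] theorem sndPow_one_lrec : sndPow 1 (lrec xu cnt st) = st := by simp [lrec]
/-- Length of the loop record. [folklore] -/
theorem length_lrec : (lrec xu cnt st).length = 2 * xu.length + 2 + (2 * cnt.length + 2 + st.length) := by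
  simp [lrec, length_boolPair]
/-- `n`. [folklore] -/
@[simp] theorem nthF_zero_xrec : nthF 0 (xrec n q A D) = encodeNat n := by simp [xrec]
/-- `2q`. [folklore] -/
@[simp] theorem nthF_one_xrec : nthF 1 (xrec n q A D) = encodeNat (2 * q) := by simp [xrec]
/-- `A`. [folklore] -/
@[simp] theorem nthF_two_xrec : nthF 2 (xrec n q A D) = encodeNat A := by simp [xrec]
/-- `D`. [folklore] -/
@[simp] theorem sndPow_two_xrec : sndPow 2 (xrec n q A D) = encodeNat D := by simp [xrec]
/-- `a`. [folklore] -/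
@[simp] theorem nthF_zero_srec : nthF 0 (srec s) = encodeNat s.a := by simp [srec, st7]
/-- `b`. [folklore] -/
@[simp] theorem nthF_one_srec : nthF 1 (srec s) = encodeNat s.b := by simp [srec, st7]
/-- `p₁`. [folklore] -/
@[simp] theorem nthF_two_srec : nthF 2 (srec s) = encodeNat s.p₁ := by simp [srec, st7]
/-- `q₁`. [folklore] -/
@[simp] theorem nthF_three_srec : nthF 3 (srec s) = encodeNat s.q₁ := by simp [srec, st7]
/-- `p₀`. [folklore] -/
@[simp] theorem nthF_four_srec : nthF 4 (srec s) = encodeNat s.p₀ := by simp [srec, st7]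
/-- `q₀`. [folklore] -/
@[simp] theorem nthF_five_srec : nthF 5 (srec s) = encodeNat s.q₀ := by simp [srec, st7]
/-- `res`. [folklore] -/
@[simp] theorem sndPow_five_srec : sndPow 5 (srec s) = encodeNat s.res := by simp [srec, st7]

end Base

/-! ### Projections of the loop record -/

/-- The context `x`. [folklore] -/
abbrev xP : List Bool → List Bool := fstF ∘ nthF 0
/-- `n`. [folklore] -/
abbrev nP : List Bool → List Bool := nthF 0 ∘ xP
/-- `2q`. [folklore] -/
abbrev q2P : List Bool → List Bool := nthF 1 ∘ xP
/-- `A`. [folklore] -/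
abbrev aAP : List Bool → List Bool := nthF 2 ∘ xP
/-- `D`. [folklore] -/
abbrev dDP : List Bool → List Bool := sndPow 2 ∘ xP
/-- The state. [folklore] -/
abbrev sP : List Bool → List Bool := sndPow 1
/-- `a`. [folklore] -/
abbrev saP : List Bool → List Bool := nthF 0 ∘ sP
/-- `b`. [folklore] -/
abbrev sbP : List Bool → List Bool := nthF 1 ∘ sP
/-- `p₁`. [folklore] -/
abbrev p1P : List Bool → List Bool := nthF 2 ∘ sP
/-- `q₁`. [folklore] -/
abbrev q1P : List Bool → List Bool := nthF 3 ∘ sP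
/-- `p₀`. [folklore] -/
abbrev p0P : List Bool → List Bool := nthF 4 ∘ sP
/-- `q₀`. [folklore] -/
abbrev q0P : List Bool → List Bool := nthF 5 ∘ sP
/-- `res`. [folklore] -/
abbrev resP : List Bool → List Bool := sndPow 5 ∘ sP

/-- Pairing of two field functions. [folklore] -/
abbrev pr (f g : List Bool → List Bool) : List Bool → List Bool := fanoutFn f g

/-! ### The arithmetic of one round -/

/-- The quotient `a / b`. [folklore] -/
def tP : List Bool → List Bool := divFn ∘ pr saP sbP
/-- The remainder `a mod b`. [folklore] -/
def rP : List Bool → List Bool := remFn ∘ pr saP sbP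
/-- The new numerator `t p₁ + p₀`. [folklore] -/
def pP : List Bool → List Bool := addFn ∘ pr (prodFn ∘ pr tP p1P) p0P
/-- The new denominator `t q₁ + q₀`. [folklore] -/
def qP : List Bool → List Bool := addFn ∘ pr (prodFn ∘ pr tP q1P) q0P
/-- `|A q' − p D|` as `(A q' ∸ p D) + (p D ∸ A q')`. [folklore] -/
def adP : List Bool → List Bool :=
  addFn ∘ pr (subFn ∘ pr (prodFn ∘ pr aAP qP) (prodFn ∘ pr pP dDP)) (subFn ∘ pr (prodFn ∘ pr pP dDP) (prodFn ∘ pr aAP qP))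
/-- Test: `q' ≠ 0`. [folklore] -/
def c1P : List Bool → List Bool := notFn (isNilFn ∘ qP)
/-- Test: `q' < n`. [folklore] -/
def c2P : List Bool → List Bool := ltFn ∘ pr qP nP
/-- Test: `¬ (D q' < 2q |A q' − p D|)`. [folklore] -/
def c3P : List Bool → List Bool := notFn (ltFn ∘ pr (prodFn ∘ pr dDP qP) (prodFn ∘ pr q2P adP))
/-- The test `cfTest` of the new convergent. [cite: Shor1997, §5 (continued fraction recovery of d/r)] -/
def testP : List Bool → List Bool := andFn c1P (andFn c2P c3P)
/-- The new result: the old one if found, else `q'` if the test passes, else `0`. [folklore] -/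
def res'P : List Bool → List Bool := iteFn (isNilFn ∘ resP) (iteFn testP qP (fun _ => [])) resP
/-- The new state. [folklore] -/
def newSP : List Bool → List Bool := pr sbP (pr rP (pr pP (pr qP (pr p1P (pr q1P res'P)))))
/-- The length cap `|b|, |p|, |q'| ≤ |⟨x, u⟩|` (never active on the states of the model). [folklore] -/
def capP : List Bool → List Bool :=
  andFn (lenLeFn X ∘ pr (nthF 0) sbP) (andFn (lenLeFn X ∘ pr (nthF 0) pP) (lenLeFn X ∘ pr (nthF 0) qP))
/-- **The body of the loop**: idle once `b = 0`, frozen beyond the cap, else the new state.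
[cite: Shor1997, §5 (continued fraction recovery of d/r); HardyWright2008, §10.2 Thm 149] -/
def cfBody : List Bool → List Bool := iteFn (isNilFn ∘ sbP) sP (iteFn capP newSP sP)

/-! ### Membership in `FP` -/

/-- `tP ∈ FP`. [folklore] -/
theorem tP_mem_FP : tP ∈ FP := comp_mem_FP divFn_mem_FP (fanoutFn_mem_FP (comp_mem_FP (nthF_mem_FP 0) (sndPow_mem_FP 1))
  (comp_mem_FP (nthF_mem_FP 1) (sndPow_mem_FP 1)))
/-- `rP ∈ FP`. [folklore] -/
theorem rP_mem_FP : rP ∈ FP := comp_mem_FP remFn_mem_FP (fanoutFn_mem_FP (comp_mem_FP (nthF_mem_FP 0) (sndPow_mem_FP 1))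
  (comp_mem_FP (nthF_mem_FP 1) (sndPow_mem_FP 1)))
/-- `pP ∈ FP`. [folklore] -/
theorem pP_mem_FP : pP ∈ FP := comp_mem_FP addFn_mem_FP (fanoutFn_mem_FP
  (comp_mem_FP prodFn_mem_FP (fanoutFn_mem_FP tP_mem_FP (comp_mem_FP (nthF_mem_FP 2) (sndPow_mem_FP 1))))
  (comp_mem_FP (nthF_mem_FP 4) (sndPow_mem_FP 1)))
/-- `qP ∈ FP`. [folklore] -/
theorem qP_mem_FP : qP ∈ FP := comp_mem_FP addFn_mem_FP (fanoutFn_mem_FP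
  (comp_mem_FP prodFn_mem_FP (fanoutFn_mem_FP tP_mem_FP (comp_mem_FP (nthF_mem_FP 3) (sndPow_mem_FP 1))))
  (comp_mem_FP (nthF_mem_FP 5) (sndPow_mem_FP 1)))
/-- `xP ∈ FP`. [folklore] -/
theorem xP_mem_FP : xP ∈ FP := comp_mem_FP fstF_mem_FP (nthF_mem_FP 0)
/-- `adP ∈ FP`. [folklore] -/
theorem adP_mem_FP : adP ∈ FP := by
  have hA : (prodFn ∘ pr aAP qP) ∈ FP := comp_mem_FP prodFn_mem_FP (fanoutFn_mem_FP (comp_mem_FP (nthF_mem_FP 2) xP_mem_FP) qP_mem_FP)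
  have hB : (prodFn ∘ pr pP dDP) ∈ FP := comp_mem_FP prodFn_mem_FP (fanoutFn_mem_FP pP_mem_FP (comp_mem_FP (sndPow_mem_FP 2) xP_mem_FP))
  exact comp_mem_FP addFn_mem_FP (fanoutFn_mem_FP (comp_mem_FP subFn_mem_FP (fanoutFn_mem_FP hA hB))
    (comp_mem_FP subFn_mem_FP (fanoutFn_mem_FP hB hA)))
/-- `testP ∈ FP`. [folklore] -/
theorem testP_mem_FP : testP ∈ FP :=
  andFn_mem_FP (notFn_mem_FP (comp_mem_FP isNilFn_mem_FP qP_mem_FP))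
    (andFn_mem_FP (comp_mem_FP ltFn_mem_FP (fanoutFn_mem_FP qP_mem_FP (comp_mem_FP (nthF_mem_FP 0) xP_mem_FP)))
      (notFn_mem_FP (comp_mem_FP ltFn_mem_FP (fanoutFn_mem_FP
        (comp_mem_FP prodFn_mem_FP (fanoutFn_mem_FP (comp_mem_FP (sndPow_mem_FP 2) xP_mem_FP) qP_mem_FP))
        (comp_mem_FP prodFn_mem_FP (fanoutFn_mem_FP (comp_mem_FP (nthF_mem_FP 1) xP_mem_FP) adP_mem_FP))))))
/-- `res'P ∈ FP`. [folklore] -/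
theorem res'P_mem_FP : res'P ∈ FP :=
  iteFn_mem_FP (comp_mem_FP isNilFn_mem_FP (comp_mem_FP (sndPow_mem_FP 5) (sndPow_mem_FP 1)))
    (iteFn_mem_FP testP_mem_FP qP_mem_FP (const_mem_FP _)) (comp_mem_FP (sndPow_mem_FP 5) (sndPow_mem_FP 1))
/-- `newSP ∈ FP`. [folklore] -/
theorem newSP_mem_FP : newSP ∈ FP :=
  fanoutFn_mem_FP (comp_mem_FP (nthF_mem_FP 1) (sndPow_mem_FP 1)) (fanoutFn_mem_FP rP_mem_FP (fanoutFn_mem_FP pP_mem_FP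
    (fanoutFn_mem_FP qP_mem_FP (fanoutFn_mem_FP (comp_mem_FP (nthF_mem_FP 2) (sndPow_mem_FP 1))
      (fanoutFn_mem_FP (comp_mem_FP (nthF_mem_FP 3) (sndPow_mem_FP 1)) res'P_mem_FP)))))
/-- `capP ∈ FP`. [folklore] -/
theorem capP_mem_FP : capP ∈ FP :=
  andFn_mem_FP (comp_mem_FP (lenLeFn_mem_FP X) (fanoutFn_mem_FP (nthF_mem_FP 0) (comp_mem_FP (nthF_mem_FP 1) (sndPow_mem_FP 1))))
    (andFn_mem_FP (comp_mem_FP (lenLeFn_mem_FP X) (fanoutFn_mem_FP (nthF_mem_FP 0) pP_mem_FP))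
      (comp_mem_FP (lenLeFn_mem_FP X) (fanoutFn_mem_FP (nthF_mem_FP 0) qP_mem_FP)))
/-- **`cfBody ∈ FP`.** [cite: AroraBarak2009, §1.3 (closure of polynomial time under composition)] -/
theorem cfBody_mem_FP : cfBody ∈ FP :=
  iteFn_mem_FP (comp_mem_FP isNilFn_mem_FP (comp_mem_FP (nthF_mem_FP 1) (sndPow_mem_FP 1))) (sndPow_mem_FP 1)
    (iteFn_mem_FP capP_mem_FP newSP_mem_FP (sndPow_mem_FP 1))

/-! ### One-bit conditions and the growth of the body -/

/-- `capP` is one-bit. [folklore] -/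
theorem oneBit_capP : OneBit capP :=
  oneBit_andFn ((oneBit_lenLeFn X).comp _) (oneBit_andFn ((oneBit_lenLeFn X).comp _) ((oneBit_lenLeFn X).comp _))

/-- `testP` is one-bit. [folklore] -/
theorem oneBit_testP : OneBit testP :=
  oneBit_andFn (oneBit_notFn (oneBit_isNilFn.comp _)) (oneBit_andFn (oneBit_ltFn.comp _) (oneBit_notFn (oneBit_ltFn.comp _)))

/-- A remainder is no longer than the dividend. [folklore] -/
theorem length_rP_le (z : List Bool) : (rP z).length ≤ (nthF 0 (sndPow 1 z)).length := by
  have h : rP z = encodeNat (bitsToNat (nthF 0 (sndPow 1 z)) % bitsToNat (nthF 1 (sndPow 1 z))) := by simp [rP]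
  rw [h]
  exact (length_encodeNat_mono (Nat.mod_le _ _)).trans (length_encodeNat_bitsToNat_le _)

/-- The new result is the old one, the new denominator, or empty. [folklore] -/
theorem length_res'P_le (z : List Bool) : (res'P z).length ≤ (sndPow 5 (sndPow 1 z)).length + (qP z).length := by
  rw [res'P, iteFn_of_oneBit (oneBit_isNilFn.comp _)]
  split_ifs
  · rw [iteFn_of_oneBit oneBit_testP]
    split_ifs <;> simp
  · simp

/-- The cap, read back. [folklore] -/
theorem cap_of_capP {z : List Bool} (h : capP z = [true]) :
    (nthF 1 (sndPow 1 z)).length ≤ (nthF 0 z).length ∧ (pP z).length ≤ (nthF 0 z).length ∧ (qP z).length ≤ (nthF 0 z).length := by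
  have e1 : (lenLeFn X ∘ pr (nthF 0) sbP) z = [decide ((nthF 1 (sndPow 1 z)).length ≤ (nthF 0 z).length)] := by
    simp [lenLeFn_boolPair]
  have e2 : (lenLeFn X ∘ pr (nthF 0) pP) z = [decide ((pP z).length ≤ (nthF 0 z).length)] := by
    simp [lenLeFn_boolPair]
  have e3 : (lenLeFn X ∘ pr (nthF 0) qP) z = [decide ((qP z).length ≤ (nthF 0 z).length)] := by
    simp [lenLeFn_boolPair]
  rw [capP, andFn_apply e1 (andFn_apply e2 e3)] at h
  simpa using h

/-- **Growth of the body**: `|cfBody z| ≤ |state| + 12 (|⟨x, u⟩| + 1)` on every record. [folklore] -/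
theorem length_cfBody_le (z : List Bool) : (cfBody z).length ≤ (sndPow 1 z).length + 12 * ((fstF z).length + 1) := by
  rw [cfBody, iteFn_of_oneBit (oneBit_isNilFn.comp _)]
  split_ifs with h1
  · simp
  rw [iteFn_of_oneBit oneBit_capP]
  split_ifs with h2
  · obtain ⟨hb, hp, hq⟩ := cap_of_capP h2
    have hx : nthF 0 z = fstF z := rfl
    rw [hx] at hb hp hq
    have f0 : 2 * (nthF 0 (sndPow 1 z)).length + (sndPow 0 (sndPow 1 z)).length ≤ (sndPow 1 z).length :=
      length_fstF_sndF_le (sndPow 1 z)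
    have f2 : 2 * (nthF 1 (sndPow 1 z)).length + (sndPow 1 (sndPow 1 z)).length ≤ (sndPow 0 (sndPow 1 z)).length :=
      length_nthF_succ_add_sndPow_succ_le 0 (sndPow 1 z)
    have f3 : 2 * (nthF 2 (sndPow 1 z)).length + (sndPow 2 (sndPow 1 z)).length ≤ (sndPow 1 (sndPow 1 z)).length :=
      length_nthF_succ_add_sndPow_succ_le 1 (sndPow 1 z)
    have f4 : 2 * (nthF 3 (sndPow 1 z)).length + (sndPow 3 (sndPow 1 z)).length ≤ (sndPow 2 (sndPow 1 z)).length :=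
      length_nthF_succ_add_sndPow_succ_le 2 (sndPow 1 z)
    have f5 : 2 * (nthF 4 (sndPow 1 z)).length + (sndPow 4 (sndPow 1 z)).length ≤ (sndPow 3 (sndPow 1 z)).length :=
      length_nthF_succ_add_sndPow_succ_le 3 (sndPow 1 z)
    have f6 : 2 * (nthF 5 (sndPow 1 z)).length + (sndPow 5 (sndPow 1 z)).length ≤ (sndPow 4 (sndPow 1 z)).length :=
      length_nthF_succ_add_sndPow_succ_le 4 (sndPow 1 z)
    have hr := length_rP_le z
    have hres := length_res'P_le z
    have e : (newSP z).length = 2 * (nthF 1 (sndPow 1 z)).length + 2 + (2 * (rP z).length + 2 + (2 * (pP z).length + 2 +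
        (2 * (qP z).length + 2 + (2 * (nthF 2 (sndPow 1 z)).length + 2 + (2 * (nthF 3 (sndPow 1 z)).length + 2 + (res'P z).length))))) := by
      simp [newSP, length_boolPair]
    omega
  · simp

/-! ### One round on a coded state -/

/-- `|a ∸ b| + |b ∸ a| = |a − b|` for naturals. [folklore] -/
theorem sub_add_sub_eq_natAbs (a b : ℕ) : (a - b) + (b - a) = Int.natAbs ((a : ℤ) - b) := by omega

/-- A numeral is empty iff its value is `0`. [folklore] -/
theorem encodeNat_eq_nil_iff (m : ℕ) : encodeNat m = [] ↔ m = 0 :=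
  ⟨fun h => by simpa using congrArg bitsToNat h, fun h => by rw [h]; rfl⟩

section Eval

variable (n q A D : ℕ) (u cnt : List Bool) (s : CF)

local notation "ρ" => lrec (boolPair (xrec n q A D) u) cnt (srec s)
local notation "p'" => s.a / s.b * s.p₁ + s.p₀
local notation "q'" => s.a / s.b * s.q₁ + s.q₀

/-- The quotient. [folklore] -/
@[simp] theorem tP_lrec : tP ρ = encodeNat (s.a / s.b) := by simp [tP]
/-- The new numerator. [folklore] -/
@[simp] theorem pP_lrec : pP ρ = encodeNat p' := by simp [pP]
/-- The new denominator. [folklore] -/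
@[simp] theorem qP_lrec : qP ρ = encodeNat q' := by simp [qP]
/-- The absolute difference. [folklore] -/
@[simp] theorem adP_lrec : adP ρ = encodeNat (Int.natAbs ((A : ℤ) * ↑(q') - ↑(p') * D)) := by
  rw [show adP ρ = encodeNat ((A * q' - p' * D) + (p' * D - A * q')) by simp [adP], sub_add_sub_eq_natAbs]
  push_cast
  rfl
/-- The test. [folklore] -/
@[simp] theorem testP_lrec : testP ρ = [cfTest n q A D (p', q')] := by
  have h1 : c1P ρ = [decide (0 < q')] := by
    rw [c1P, notFn_apply (b := decide (q' = 0)) (by simp [isNilFn, encodeNat_eq_nil_iff])]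
    simp only [Nat.pos_iff_ne_zero, ne_eq, decide_not]
  have h2 : c2P ρ = [decide (q' < n)] := by simp [c2P]
  have h3 : c3P ρ = [decide (2 * q * Int.natAbs ((A : ℤ) * ↑(q') - ↑(p') * D) ≤ D * q')] := by
    rw [c3P, notFn_apply (b := decide (D * q' < 2 * q * Int.natAbs ((A : ℤ) * ↑(q') - ↑(p') * D)))]
    · simp only [← decide_not, not_lt]
    · simp
  rw [testP, andFn_apply h1 (andFn_apply h2 h3), cfTest]
  simp only [Bool.decide_and]
/-- The new result. [folklore] -/
@[simp] theorem res'P_lrec : res'P ρ = encodeNat (if s.res ≠ 0 then s.res else if cfTest n q A D (p', q') then q' else 0) := by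
  rw [res'P, iteFn_of_oneBit (oneBit_isNilFn.comp _)]
  have hres0 : ((isNilFn ∘ resP) ρ = [true]) ↔ s.res = 0 := by simp [isNilFn, encodeNat_eq_nil_iff]
  by_cases hr : s.res = 0
  · rw [if_pos (hres0.2 hr), if_neg (by simpa using hr), iteFn_of_oneBit oneBit_testP, testP_lrec]
    by_cases ht : cfTest n q A D (p', q') = true
    · rw [if_pos (by rw [ht]), if_pos ht, qP_lrec]
    · rw [if_neg (by simp [ht]), if_neg ht]; rfl
  · rw [if_neg (fun h => hr (hres0.1 h)), if_pos hr]
    simp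

/-- **One round on a coded state within the cap** is the coded next state. [cite: Shor1997, §5 (continued fraction recovery of d/r); HardyWright2008, §10.2 Thm 149] -/
theorem cfBody_lrec (hb : (encodeNat s.b).length ≤ (boolPair (xrec n q A D) u).length)
    (hp : s.b ≠ 0 → (encodeNat p').length ≤ (boolPair (xrec n q A D) u).length)
    (hq : s.b ≠ 0 → (encodeNat q').length ≤ (boolPair (xrec n q A D) u).length) :
    cfBody ρ = srec (cfNext n q A D s) := by
  by_cases h0 : s.b = 0
  · rw [cfBody, iteFn_apply_true (by simp [isNilFn, h0]; rfl)]
    simp [cfNext, h0]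
  · rw [cfBody, iteFn_apply_false (by simp [isNilFn, encodeNat_eq_nil_iff, h0]),
      iteFn_apply_true (by
        rw [capP, andFn_apply (b := true) _ (andFn_apply (b := true) (b' := true) _ _)]
        · simp
        · simpa [lenLeFn_boolPair] using hb
        · simpa [lenLeFn_boolPair] using hp h0
        · simpa [lenLeFn_boolPair] using hq h0)]
    rw [cfNext, if_neg h0]
    simp only [newSP, fanoutFn_apply, Function.comp_apply, sndPow_one_lrec, nthF_one_srec, nthF_two_srec,
      nthF_three_srec, pP_lrec, qP_lrec, res'P_lrec]
    rw [show rP ρ = encodeNat (s.a % s.b) by simp [rP]]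
    simp [srec, st7]

end Eval

/-! ### The states of the model stay within the cap -/

/-- The numeral of a number `≤ max m 1` is no longer than `max |numeral m| 1`. [folklore] -/
theorem length_encodeNat_le_max {v m : ℕ} (h : v ≤ max m 1) : (encodeNat v).length ≤ max (encodeNat m).length 1 := by
  rcases le_max_iff.1 h with h | h
  · exact (length_encodeNat_mono h).trans (le_max_left _ _)
  · exact (length_encodeNat_mono h).trans (by simp [show encodeNat 1 = [true] from rfl])

/-- Length of the context. [folklore] -/
theorem length_xrec (n q A D : ℕ) : (xrec n q A D).length =
    2 * (encodeNat n).length + 2 + (2 * (encodeNat (2 * q)).length + 2 + (2 * (encodeNat A).length + 2 + (encodeNat D).length)) := by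
  simp [xrec, length_boolPair]

/-- **The cap is never active on the model**: Euclid's `b ≤ D`, and a new convergent of `A/D`
has numerator `≤ max A 1`, denominator `≤ max D 1` (`evalFrac_quots_le`). [folklore] -/
theorem cap_iterate (n q A D : ℕ) (u : List Bool) (j : ℕ) :
    (encodeNat ((cfNext n q A D)^[j] (cfInit A D)).b).length ≤ (boolPair (xrec n q A D) u).length ∧
    (((cfNext n q A D)^[j] (cfInit A D)).b ≠ 0 →
      (encodeNat (((cfNext n q A D)^[j] (cfInit A D)).a / ((cfNext n q A D)^[j] (cfInit A D)).b *
        ((cfNext n q A D)^[j] (cfInit A D)).p₁ + ((cfNext n q A D)^[j] (cfInit A D)).p₀)).length ≤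
          (boolPair (xrec n q A D) u).length) ∧
    (((cfNext n q A D)^[j] (cfInit A D)).b ≠ 0 →
      (encodeNat (((cfNext n q A D)^[j] (cfInit A D)).a / ((cfNext n q A D)^[j] (cfInit A D)).b *
        ((cfNext n q A D)^[j] (cfInit A D)).q₁ + ((cfNext n q A D)^[j] (cfInit A D)).q₀)).length ≤
          (boolPair (xrec n q A D) u).length) := by
  obtain ⟨ha, hb, hP, -⟩ := cfNext_iterate_spec n q A D j
  set s := (cfNext n q A D)^[j] (cfInit A D)
  have hlen : (boolPair (xrec n q A D) u).length = 2 * (xrec n q A D).length + 2 + u.length := length_boolPair _ _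
  have hx := length_xrec n q A D
  refine ⟨?_, fun h0 => ?_, fun h0 => ?_⟩
  · have := length_encodeNat_mono ((euclidStep_iterate_le A D j).2.1)
    rw [← hb] at this
    omega
  all_goals
    have hfwd : ∀ l t, cfFwd (l ++ [t]) = cfStep (cfFwd l) t := fun l t => by simp [cfFwd, List.foldl_append]
    have hb0 : ¬ (euclidStep^[j] (A, D)).2 = 0 := hb ▸ h0
    have hev : evalFrac (quots A D (j + 1)) = (s.a / s.b * s.p₁ + s.p₀, s.a / s.b * s.q₁ + s.q₀) := by
      rw [quots_succ, if_neg hb0, ← cfFwd_eq_evalFrac, hfwd, ← hP, cfStep, ← ha, ← hb]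
    obtain ⟨h1, h2⟩ := evalFrac_quots_le (j + 1) A D
    rw [hev] at h1 h2
    dsimp only at h1 h2
  · have := length_encodeNat_le_max h1
    have h3 : max (encodeNat A).length 1 ≤ (xrec n q A D).length := by rw [hx]; omega
    omega
  · have := length_encodeNat_le_max h2
    have h3 : max (encodeNat D).length 1 ≤ (xrec n q A D).length := by rw [hx]; omega
    omega

/-- **The loop runs the model.** [folklore] -/
theorem loopModel_cfBody (n q A D : ℕ) (u : List Bool) : ∀ k j : ℕ,
    loopModel cfBody (boolPair (xrec n q A D) u) k (srec ((cfNext n q A D)^[j] (cfInit A D))) =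
      srec ((cfNext n q A D)^[j + k] (cfInit A D))
  | 0, j => rfl
  | k + 1, j => by
    obtain ⟨hb, hp, hq⟩ := cap_iterate n q A D u j
    rw [loopModel, show boolPair (boolPair (xrec n q A D) u) (boolPair (encodeNat (k + 1)) (srec ((cfNext n q A D)^[j] (cfInit A D)))) =
      lrec (boolPair (xrec n q A D) u) (encodeNat (k + 1)) (srec ((cfNext n q A D)^[j] (cfInit A D))) from rfl,
      cfBody_lrec n q A D u _ _ hb hp hq, ← Function.iterate_succ_apply' (cfNext n q A D), loopModel_cfBody n q A D u k (j + 1)]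
    congr 2
    omega

/-! ### The scan -/

/-- The initial loop record from the input `w = ⟨x, u⟩` (`x = ⟨n, ⟨2q, ⟨A, D⟩⟩⟩`, `u` the unary round
count): `⟨w, ⟨bin |u|, ⟨A, ⟨D, ⟨1, ⟨0, ⟨0, ⟨1, 0⟩⟩⟩⟩⟩⟩⟩⟩`. [cite: HardyWright2008, §10.2 (Thm 149: initial values of the recurrence)] -/
def cfInitP : List Bool → List Bool :=
  pr idF (pr (lenBinF ∘ sndF) (pr (nthF 2 ∘ fstF) (pr (sndPow 2 ∘ fstF) (pr (fun _ => [true]) (pr (fun _ => [])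
    (pr (fun _ => []) (pr (fun _ => [true]) (fun _ => []))))))))

/-- `cfInitP ∈ FP`. [folklore] -/
theorem cfInitP_mem_FP : cfInitP ∈ FP :=
  fanoutFn_mem_FP idF_mem_FP (fanoutFn_mem_FP (comp_mem_FP lenBinF_mem_FP sndF_mem_FP)
    (fanoutFn_mem_FP (comp_mem_FP (nthF_mem_FP 2) fstF_mem_FP) (fanoutFn_mem_FP (comp_mem_FP (sndPow_mem_FP 2) fstF_mem_FP)
      (fanoutFn_mem_FP (const_mem_FP _) (fanoutFn_mem_FP (const_mem_FP _) (fanoutFn_mem_FP (const_mem_FP _)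
        (fanoutFn_mem_FP (const_mem_FP _) (const_mem_FP _))))))))

/-- The initial record on a coded input. [folklore] -/
theorem cfInitP_apply (n q A D : ℕ) (u : List Bool) :
    cfInitP (boolPair (xrec n q A D) u) = lrec (boolPair (xrec n q A D) u) (encodeNat u.length) (srec (cfInit A D)) := by
  simp [cfInitP, idF, lrec, srec, st7, cfInit, show encodeNat 1 = [true] from rfl, show encodeNat 0 = [] from rfl]

/-- **The continued-fraction scan**: `|u|` rounds of the loop from the initial record, then the
result field. [cite: Shor1997, §5 (continued fraction recovery of d/r)] -/
def cfScanF : List Bool → List Bool :=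
  resP ∘ (fun z => (loopStep cfBody)^[(X : Polynomial ℕ).eval (fstF z).length] z) ∘ cfInitP

/-- **`cfScanF ∈ FP`** (`loopFn_mem_FP` with the growth bound `length_cfBody_le`).
[cite: AroraBarak2009, §1.3 (bounded loops), §1.4.1] -/
theorem cfScanF_mem_FP : cfScanF ∈ FP :=
  comp_mem_FP (comp_mem_FP (sndPow_mem_FP 5) (sndPow_mem_FP 1))
    (comp_mem_FP (loopFn_mem_FP cfBody_mem_FP length_cfBody_le X) cfInitP_mem_FP)

/-- **The scan computes Shor's candidate by continued fractions**:
`cfScanF ⟨⟨n, ⟨2q, ⟨A, D⟩⟩⟩, u⟩ = encodeNat (cfCandidate n q A D |u|)`. [cite: Shor1997, §5 (continued fraction recovery of d/r); HardyWright2008, §10.2 Thm 149] -/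
theorem cfScanF_apply (n q A D : ℕ) (u : List Bool) :
    cfScanF (boolPair (xrec n q A D) u) = encodeNat (cfCandidate n q A D u.length) := by
  obtain ⟨-, -, -, hres⟩ := cfNext_iterate_spec n q A D u.length
  simp only [cfScanF, Function.comp_apply, cfInitP_apply, fstF_lrec, eval_X]
  rw [lrec, iterate_loopStep cfBody _ u.length _ _ (by simp), show (cfInit A D) = (cfNext n q A D)^[0] (cfInit A D) from rfl,
    loopModel_cfBody, Nat.zero_add, ← lrec]
  simp only [sndPow_one_lrec, sndPow_five_srec, hres]

end OFPostB

end Literature.Computability.Cryptography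

end
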